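import Summits.RiemannHypothesis.RiemannHypothesis.Theorems.JensenPolynomialsFarGumbelDefs
import Summits.RiemannHypothesis.RiemannHypothesis.Theorems.JensenPolynomialsTruncatedBinomialTwoBranch

/-!
# Route `JensenPolynomials`, FAR crux `XiWindowZeroFreeRelFar` (B1-rel far) — line «far-gumbel», stub S2 `stub_junk`, part A:
the SPLIT of `I − J` into the low region and the truncation remainder (RH-FREE; cell rh-jensen, HUMAN RULING D-0040;
helper for item `stmt-RiemannHypothesis-19465`)

With `I(M,s) = winI M s = ∫₀^∞ Φ(u)u^{2M}T_M(a/u²)du` (`a = farA M s = s·c_M/(M−½)`, `T_M` the truncated binomial series of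
`…TruncatedBinomial*`) and `J = winJ M υ a = ∫_{υ−2}^∞ Φ(u)·u·(u²+a)^{M−½}du` (principal power), for `υ > 2` and
`‖a‖ < (υ−2)²` (so that `|a/u²| < 1` on the `J`-range):

* §1 the integrand of `winI` in the variable `a` and its integrability on `(0, ∞)` (finite sum of moments);
* §2 the bulk identity `u^{2M}·(1 + a/u²)^{M−½} = u·(u² + a)^{M−½}` for `u > 0`, `1 + a/u² ≠ 0` (principal powers), and the
  integrability of the `J`-integrand;
* §3 **`‖I − J‖ ≤ ∫_{(0,υ−2]} Φ(u)u^{2M}‖T_M(a/u²)‖du + ∫_{(υ−2,∞)} Φ(u)u^{2M}‖T_M(a/u²) − (1+a/u²)^{M−½}‖du`**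
  (`norm_winI_sub_winJ_le`) — the two real integrals that parts B/C bound by `e^{−M/10}·farEnv` region by region
  (crude bound below `0.4υ`, the two-branch bound `WindowEGF.norm_truncBinom_sub_cpow_le` in between and beyond).

WHAT THIS IS NOT: measure-theoretic bookkeeping; nothing here bears on the zeros of `ζ` or the truth of RH.
References: [GORZPNAS2019]; theory g8's line card `far-gumbel` v3 (HOME rh-jensen-theory/g8/lines/).
-/

noncomputable section
-- D-0017: `Summit.RiemannHypothesis.RiemannHypothesis.…` duplicates the namespace BY DESIGN (single-problem summit).
set_option linter.dupNamespace false

namespace Summit.RiemannHypothesis.RiemannHypothesis.Theorems.JensenPolynomials.FarGumbel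

open Literature.NumberTheory.LFunctions MeasureTheory Set Complex
open scoped Real

/-! ## 1. The `winI` integrand in the variable `a = farA M s` -/

/-- The inner argument of `winI`: `s·c_M/((M−½)u²) = a/u²`. -/
theorem winI_arg_eq (M : ℕ) (s : ℂ) (u : ℝ) :
    s * (((xiMoment (2 * M) / xiMoment (2 * M - 2) : ℝ)) : ℂ) / (((((M : ℝ) - 1 / 2 : ℝ)) : ℂ) * (u : ℂ) ^ 2) =
      farA M s / (u : ℂ) ^ 2 := by
  unfold farA cM
  rw [div_mul_eq_div_div]

/-- `winI` written with `T_M(a/u²)`. -/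
theorem winI_eq (M : ℕ) (s : ℂ) :
    winI M s = ∫ u in Set.Ioi (0 : ℝ), ((deBruijnPhi u * u ^ (2 * M) : ℝ) : ℂ) *
      ∑ k ∈ Finset.range (M + 1),
        ((((descPochhammer ℝ k).eval ((M : ℝ) - 1 / 2) / (Nat.factorial k : ℝ) : ℝ)) : ℂ) *
          (farA M s / (u : ℂ) ^ 2) ^ k := by
  unfold winI
  refine setIntegral_congr_fun measurableSet_Ioi fun u _ ↦ ?_
  simp only [winI_arg_eq]

/-- On `(0, ∞)` the integrand is a finite sum of moment integrands `(c_k a^k)·Φ(u)u^{2M−2k}`. -/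
theorem winI_integrand_eqOn (M : ℕ) (a : ℂ) :
    Set.EqOn
      (fun u : ℝ ↦ ((deBruijnPhi u * u ^ (2 * M) : ℝ) : ℂ) *
        ∑ k ∈ Finset.range (M + 1),
          ((((descPochhammer ℝ k).eval ((M : ℝ) - 1 / 2) / (Nat.factorial k : ℝ) : ℝ)) : ℂ) * (a / (u : ℂ) ^ 2) ^ k)
      (fun u : ℝ ↦ ∑ k ∈ Finset.range (M + 1),
        (((((descPochhammer ℝ k).eval ((M : ℝ) - 1 / 2) / (Nat.factorial k : ℝ) : ℝ)) : ℂ) * a ^ k) *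
          ((deBruijnPhi u * u ^ (2 * M - 2 * k) : ℝ) : ℂ))
      (Set.Ioi (0 : ℝ)) := by
  intro u hu
  have hu0 : (u : ℂ) ≠ 0 := by exact_mod_cast (ne_of_gt hu)
  simp only
  rw [Finset.mul_sum]
  refine Finset.sum_congr rfl fun k hk ↦ ?_
  have hkM : k ≤ M := Nat.lt_succ_iff.mp (Finset.mem_range.mp hk)
  have hX : ((u : ℂ) ^ 2) ^ k ≠ 0 := pow_ne_zero _ (pow_ne_zero _ hu0)
  have hsplit : (u : ℂ) ^ (2 * M) = (u : ℂ) ^ (2 * M - 2 * k) * ((u : ℂ) ^ 2) ^ k := by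
    rw [← pow_mul, ← pow_add]; congr 1; omega
  rw [div_pow]
  push_cast
  rw [hsplit]
  field_simp

/-- The `winI`-integrand (in the variable `a`) is integrable on `(0, ∞)`. -/
theorem integrableOn_winI_integrand (M : ℕ) (a : ℂ) :
    IntegrableOn (fun u : ℝ ↦ ((deBruijnPhi u * u ^ (2 * M) : ℝ) : ℂ) *
        ∑ k ∈ Finset.range (M + 1),
          ((((descPochhammer ℝ k).eval ((M : ℝ) - 1 / 2) / (Nat.factorial k : ℝ) : ℝ)) : ℂ) * (a / (u : ℂ) ^ 2) ^ k)
      (Set.Ioi (0 : ℝ)) := by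
  refine IntegrableOn.congr_fun ?_ (winI_integrand_eqOn M a).symm measurableSet_Ioi
  refine MeasureTheory.integrable_finsetSum _ fun k _ ↦ ?_
  exact ((integrableOn_deBruijnPhi_mul_pow (2 * M - 2 * k)).ofReal).const_mul _

/-! ## 2. The bulk power identity and the `J`-integrand -/

/-- `(u²)^{M−½} = u^{2M−1}` (real powers, `u ≥ 0`, `M ≥ 1`). -/
theorem sq_rpow_halfExp {M : ℕ} (hM : 1 ≤ M) {u : ℝ} (hu : 0 ≤ u) :
    (u ^ 2) ^ ((M : ℝ) - 1 / 2) = u ^ (2 * M - 1) := by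
  rw [show (u ^ 2 : ℝ) = u ^ ((2 : ℕ) : ℝ) by rw [Real.rpow_natCast], ← Real.rpow_mul hu]
  have h : ((2 : ℕ) : ℝ) * ((M : ℝ) - 1 / 2) = ((2 * M - 1 : ℕ) : ℝ) := by
    rw [Nat.cast_sub (by omega)]; push_cast; ring
  rw [h, Real.rpow_natCast]

/-- **Bulk identity**: `u^{2M}·(1 + a/u²)^{M−½} = u·(u² + a)^{M−½}` for `u > 0` and `1 + a/u² ≠ 0` (principal powers;
`(u²·z)^c = (u²)^c·z^c` because `u² > 0`). -/
theorem bulk_cpow_identity {M : ℕ} (hM : 1 ≤ M) {u : ℝ} (hu : 0 < u) {a : ℂ} (h1 : 1 + a / (u : ℂ) ^ 2 ≠ 0) :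
    (u : ℂ) ^ (2 * M) * (1 + a / (u : ℂ) ^ 2) ^ ((((M : ℝ) - 1 / 2 : ℝ)) : ℂ) =
      (u : ℂ) * (((u : ℂ) ^ 2 + a) ^ ((M : ℂ) - 1 / 2)) := by
  have hu0 : (u : ℂ) ≠ 0 := by exact_mod_cast hu.ne'
  have hu2 : (0 : ℝ) < u ^ 2 := by positivity
  have hc : ((M : ℂ) - 1 / 2) = ((((M : ℝ) - 1 / 2 : ℝ)) : ℂ) := by push_cast; ring
  rw [hc]
  set c : ℂ := ((((M : ℝ) - 1 / 2 : ℝ)) : ℂ) with hcdef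
  -- `u² + a = u²·(1 + a/u²)`
  have hfac : ((u : ℂ) ^ 2 + a) = (((u ^ 2 : ℝ)) : ℂ) * (1 + a / (u : ℂ) ^ 2) := by
    push_cast; field_simp
  rw [hfac]
  -- `(u²·z)^c = (u²)^c · z^c`
  have hz : (1 + a / (u : ℂ) ^ 2) ≠ 0 := h1
  have hprod : ((((u ^ 2 : ℝ)) : ℂ) * (1 + a / (u : ℂ) ^ 2)) ^ c =
      (((u ^ 2 : ℝ)) : ℂ) ^ c * (1 + a / (u : ℂ) ^ 2) ^ c := by
    have hne : (((u ^ 2 : ℝ)) : ℂ) * (1 + a / (u : ℂ) ^ 2) ≠ 0 :=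
      mul_ne_zero (by exact_mod_cast hu2.ne') hz
    rw [cpow_def_of_ne_zero hne, cpow_def_of_ne_zero (by exact_mod_cast hu2.ne'), cpow_def_of_ne_zero hz,
      Complex.log_ofReal_mul hu2 hz, add_mul, Complex.exp_add, Complex.ofReal_log hu2.le]
  rw [hprod]
  -- `(u²)^c = u^{2M−1}`
  have hreal : (((u ^ 2 : ℝ)) : ℂ) ^ c = (((u ^ (2 * M - 1) : ℝ)) : ℂ) := by
    rw [hcdef, ← Complex.ofReal_cpow hu2.le, sq_rpow_halfExp hM hu.le]
  rw [hreal]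
  push_cast
  have hpow : (u : ℂ) ^ (2 * M) = (u : ℂ) * (u : ℂ) ^ (2 * M - 1) := by
    rw [← pow_succ']; congr 1; omega
  rw [hpow]
  ring

/-- Norm of the bulk power: `‖(u² + a)^{M−½}‖ ≤ 2^M·u^{2M−1}` for `u > 0`, `‖a‖ ≤ u²`. -/
theorem norm_sq_add_cpow_le {M : ℕ} (hM : 1 ≤ M) {u : ℝ} (hu : 0 < u) {a : ℂ} (ha : ‖a‖ ≤ u ^ 2) :
    ‖((u : ℂ) ^ 2 + a) ^ ((M : ℂ) - 1 / 2)‖ ≤ 2 ^ M * u ^ (2 * M - 1) := by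
  have hc : ((M : ℂ) - 1 / 2) = ((((M : ℝ) - 1 / 2 : ℝ)) : ℂ) := by push_cast; ring
  rw [hc, Complex.norm_cpow_real]
  have hN0 : 0 ≤ (M : ℝ) - 1 / 2 := by
    have : (1 : ℝ) ≤ M := by exact_mod_cast hM
    linarith
  have hbase : ‖(u : ℂ) ^ 2 + a‖ ≤ 2 * u ^ 2 := by
    calc ‖(u : ℂ) ^ 2 + a‖ ≤ ‖(u : ℂ) ^ 2‖ + ‖a‖ := norm_add_le _ _
      _ = u ^ 2 + ‖a‖ := by rw [norm_pow, Complex.norm_real, Real.norm_of_nonneg hu.le]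
      _ ≤ 2 * u ^ 2 := by linarith
  calc ‖(u : ℂ) ^ 2 + a‖ ^ ((M : ℝ) - 1 / 2) ≤ (2 * u ^ 2) ^ ((M : ℝ) - 1 / 2) :=
        Real.rpow_le_rpow (norm_nonneg _) hbase hN0
    _ = 2 ^ ((M : ℝ) - 1 / 2) * (u ^ 2) ^ ((M : ℝ) - 1 / 2) :=
        Real.mul_rpow (by norm_num) (by positivity)
    _ ≤ 2 ^ (M : ℝ) * (u ^ 2) ^ ((M : ℝ) - 1 / 2) := by
        have h2 : (2 : ℝ) ^ ((M : ℝ) - 1 / 2) ≤ 2 ^ (M : ℝ) :=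
          Real.rpow_le_rpow_of_exponent_le (by norm_num) (by linarith)
        exact mul_le_mul_of_nonneg_right h2 (Real.rpow_nonneg (by positivity) _)
    _ = 2 ^ M * u ^ (2 * M - 1) := by rw [Real.rpow_natCast, sq_rpow_halfExp hM hu.le]

/-- For `u > c > 0` with `‖a‖ < c²`: `u² + a` lies in the slit plane and `1 + a/u² ≠ 0`. -/
theorem sq_add_mem_slitPlane_of_lt {c u : ℝ} (hc : 0 < c) (hcu : c < u) {a : ℂ} (ha : ‖a‖ < c ^ 2) :
    ((u : ℂ) ^ 2 + a) ∈ slitPlane ∧ 1 + a / (u : ℂ) ^ 2 ≠ 0 := by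
  have hu : 0 < u := hc.trans hcu
  have hu2 : c ^ 2 < u ^ 2 := by nlinarith
  have hre : 0 < ((u : ℂ) ^ 2 + a).re := by
    have h1 : ((u : ℂ) ^ 2).re = u ^ 2 := by
      rw [← Complex.ofReal_pow]; exact Complex.ofReal_re _
    have h2 : |a.re| ≤ ‖a‖ := Complex.abs_re_le_norm a
    rw [Complex.add_re, h1]
    have := neg_abs_le a.re
    linarith
  refine ⟨Complex.mem_slitPlane_iff.mpr (Or.inl hre), ?_⟩
  intro h0
  have hu0 : (u : ℂ) ^ 2 ≠ 0 := pow_ne_zero _ (by exact_mod_cast hu.ne')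
  have : (u : ℂ) ^ 2 + a = 0 := by
    have := congrArg (fun z ↦ z * (u : ℂ) ^ 2) h0
    simp only [add_mul, zero_mul, div_mul_cancel₀ _ hu0, one_mul] at this
    exact this
  rw [this, Complex.zero_re] at hre
  exact lt_irrefl _ hre

/-- The `J`-integrand is integrable on `(c, ∞)` when `c > 0` and `‖a‖ < c²`. -/
theorem integrableOn_winJ_integrand {M : ℕ} (hM : 1 ≤ M) {c : ℝ} (hc : 0 < c) {a : ℂ} (ha : ‖a‖ < c ^ 2) :
    IntegrableOn (fun u : ℝ ↦ ((deBruijnPhi u * u : ℝ) : ℂ) * (((u : ℂ) ^ 2 + a) ^ ((M : ℂ) - 1 / 2)))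
      (Set.Ioi c) := by
  -- measurability: continuity on `(c, ∞)`
  have hcont : ContinuousOn (fun u : ℝ ↦ ((deBruijnPhi u * u : ℝ) : ℂ) * (((u : ℂ) ^ 2 + a) ^ ((M : ℂ) - 1 / 2)))
      (Set.Ioi c) := by
    intro u hu
    have hslit := (sq_add_mem_slitPlane_of_lt hc hu ha).1
    have h1 : ContinuousAt (fun u : ℝ ↦ ((deBruijnPhi u * u : ℝ) : ℂ)) u :=
      (Complex.continuous_ofReal.comp (continuous_deBruijnPhi.mul continuous_id)).continuousAt
    have h2 : ContinuousAt (fun u : ℝ ↦ ((u : ℂ) ^ 2 + a) ^ ((M : ℂ) - 1 / 2)) u := by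
      have hb : ContinuousAt (fun u : ℝ ↦ (u : ℂ) ^ 2 + a) u :=
        ((Complex.continuous_ofReal.pow 2).add continuous_const).continuousAt
      exact hb.cpow continuousAt_const hslit
    exact (h1.mul h2).continuousWithinAt
  -- domination by `2^M Φ(u) u^{2M}`
  have hdom : IntegrableOn (fun u : ℝ ↦ (2 : ℝ) ^ M * (deBruijnPhi u * u ^ (2 * M))) (Set.Ioi c) :=
    ((integrableOn_deBruijnPhi_mul_pow (2 * M)).mono_set (Set.Ioi_subset_Ioi hc.le)).const_mul _
  refine Integrable.mono' hdom (hcont.aestronglyMeasurable measurableSet_Ioi) ?_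
  refine (ae_restrict_iff' measurableSet_Ioi).mpr (Filter.Eventually.of_forall fun u hcu ↦ ?_)
  have hcu' : c < u := hcu
  have hu : 0 < u := hc.trans hcu'
  have hau : ‖a‖ ≤ u ^ 2 := by
    have : c ^ 2 < u ^ 2 := by nlinarith [hc, hcu']
    linarith
  rw [norm_mul, Complex.norm_real, Real.norm_of_nonneg (mul_nonneg (deBruijnPhi_pos_of_nonneg hu.le).le hu.le)]
  have hΦ := (deBruijnPhi_pos_of_nonneg hu.le).le
  calc deBruijnPhi u * u * ‖((u : ℂ) ^ 2 + a) ^ ((M : ℂ) - 1 / 2)‖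
      ≤ deBruijnPhi u * u * (2 ^ M * u ^ (2 * M - 1)) := by
        apply mul_le_mul_of_nonneg_left (norm_sq_add_cpow_le hM hu hau) (mul_nonneg hΦ hu.le)
    _ = 2 ^ M * (deBruijnPhi u * u ^ (2 * M)) := by
        have : u * u ^ (2 * M - 1) = u ^ (2 * M) := by rw [← pow_succ']; congr 1; omega
        rw [← this]; ring

/-! ## 3. The split `‖I − J‖ ≤ (low region) + (truncation remainder)` -/

/-- **The split.** For `M ≥ 1`, `υ > 2` and `‖a‖ < (υ−2)²` (`a = farA M s`):
`‖I − J‖ ≤ ∫_{(0,υ−2]} Φ(u)u^{2M}‖T_M(a/u²)‖ + ∫_{(υ−2,∞)} Φ(u)u^{2M}‖T_M(a/u²) − (1 + a/u²)^{M−½}‖`. -/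
theorem norm_winI_sub_winJ_le (M : ℕ) (hM : 1 ≤ M) (s : ℂ) {υ : ℝ} (hυ : 2 < υ)
    (ha : ‖farA M s‖ < (υ - 2) ^ 2) :
    ‖winI M s - winJ M υ (farA M s)‖ ≤
      (∫ u in Set.Ioc (0 : ℝ) (υ - 2), deBruijnPhi u * u ^ (2 * M) *
        ‖∑ k ∈ Finset.range (M + 1),
          ((((descPochhammer ℝ k).eval ((M : ℝ) - 1 / 2) / (Nat.factorial k : ℝ) : ℝ)) : ℂ) *
            (farA M s / (u : ℂ) ^ 2) ^ k‖) +
      ∫ u in Set.Ioi (υ - 2), deBruijnPhi u * u ^ (2 * M) *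
        ‖∑ k ∈ Finset.range (M + 1),
            ((((descPochhammer ℝ k).eval ((M : ℝ) - 1 / 2) / (Nat.factorial k : ℝ) : ℝ)) : ℂ) *
              (farA M s / (u : ℂ) ^ 2) ^ k -
          (1 + farA M s / (u : ℂ) ^ 2) ^ ((((M : ℝ) - 1 / 2 : ℝ)) : ℂ)‖ := by
  set a : ℂ := farA M s with hadef
  set c : ℝ := υ - 2 with hcdef
  have hc : 0 < c := by rw [hcdef]; linarith
  -- the integrands
  set F : ℝ → ℂ := fun u ↦ ((deBruijnPhi u * u ^ (2 * M) : ℝ) : ℂ) *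
    ∑ k ∈ Finset.range (M + 1),
      ((((descPochhammer ℝ k).eval ((M : ℝ) - 1 / 2) / (Nat.factorial k : ℝ) : ℝ)) : ℂ) * (a / (u : ℂ) ^ 2) ^ k
    with hFdef
  set g : ℝ → ℂ := fun u ↦ ((deBruijnPhi u * u : ℝ) : ℂ) * (((u : ℂ) ^ 2 + a) ^ ((M : ℂ) - 1 / 2)) with hgdef
  have hFint : IntegrableOn F (Set.Ioi 0) := integrableOn_winI_integrand M a
  have hgint : IntegrableOn g (Set.Ioi c) := integrableOn_winJ_integrand hM hc ha
  -- split `I`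
  have hI : winI M s = (∫ u in Set.Ioc 0 c, F u) + ∫ u in Set.Ioi c, F u := by
    rw [winI_eq, ← hadef]
    have hunion : Set.Ioi (0 : ℝ) = Set.Ioc 0 c ∪ Set.Ioi c := (Set.Ioc_union_Ioi_eq_Ioi hc.le).symm
    have hdisj : Disjoint (Set.Ioc (0 : ℝ) c) (Set.Ioi c) :=
      Set.disjoint_left.mpr fun u hu1 hu2 ↦ absurd hu1.2 (not_le.mpr hu2)
    rw [show (∫ u in Set.Ioi (0 : ℝ), F u) = ∫ u in Set.Ioc 0 c ∪ Set.Ioi c, F u by rw [← hunion]]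
    exact setIntegral_union hdisj measurableSet_Ioi (hFint.mono_set Set.Ioc_subset_Ioi_self)
      (hFint.mono_set (Set.Ioi_subset_Ioi hc.le))
  have hJ : winJ M υ a = ∫ u in Set.Ioi c, g u := by rw [hcdef]; rfl
  -- on `(c, ∞)`: `F − g = Φ u^{2M}·[T_M(w) − (1+w)^{M−½}]`
  have hdiff : Set.EqOn (fun u ↦ F u - g u)
      (fun u : ℝ ↦ ((deBruijnPhi u * u ^ (2 * M) : ℝ) : ℂ) *
        (∑ k ∈ Finset.range (M + 1),
            ((((descPochhammer ℝ k).eval ((M : ℝ) - 1 / 2) / (Nat.factorial k : ℝ) : ℝ)) : ℂ) * (a / (u : ℂ) ^ 2) ^ k -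
          (1 + a / (u : ℂ) ^ 2) ^ ((((M : ℝ) - 1 / 2 : ℝ)) : ℂ))) (Set.Ioi c) := by
    intro u hu
    have hu0 : 0 < u := hc.trans hu
    have h1 := (sq_add_mem_slitPlane_of_lt hc hu ha).2
    have hb := bulk_cpow_identity hM hu0 h1
    have hg' : g u = ((deBruijnPhi u * u ^ (2 * M) : ℝ) : ℂ) * (1 + a / (u : ℂ) ^ 2) ^ ((((M : ℝ) - 1 / 2 : ℝ)) : ℂ) := by
      simp only [hgdef, Complex.ofReal_mul, Complex.ofReal_pow]
      linear_combination (-(deBruijnPhi u : ℂ)) * hb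
    simp only [hFdef]
    rw [hg', mul_sub]
  -- assemble
  have hsub : winI M s - winJ M υ a = (∫ u in Set.Ioc 0 c, F u) + ∫ u in Set.Ioi c, (F u - g u) := by
    rw [hI, hJ, integral_sub (hFint.mono_set (Set.Ioi_subset_Ioi hc.le)) hgint]
    ring
  rw [hsub]
  have hn1 : ‖∫ u in Set.Ioc 0 c, F u‖ ≤ ∫ u in Set.Ioc (0 : ℝ) c, deBruijnPhi u * u ^ (2 * M) *
      ‖∑ k ∈ Finset.range (M + 1),
        ((((descPochhammer ℝ k).eval ((M : ℝ) - 1 / 2) / (Nat.factorial k : ℝ) : ℝ)) : ℂ) * (a / (u : ℂ) ^ 2) ^ k‖ := by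
    refine (norm_integral_le_integral_norm _).trans (le_of_eq ?_)
    refine setIntegral_congr_fun measurableSet_Ioc fun u hu ↦ ?_
    simp only [hFdef]
    rw [norm_mul, Complex.norm_real,
      Real.norm_of_nonneg (mul_nonneg (deBruijnPhi_pos_of_nonneg hu.1.le).le (pow_nonneg hu.1.le _))]
  have hn2 : ‖∫ u in Set.Ioi c, (F u - g u)‖ ≤ ∫ u in Set.Ioi c, deBruijnPhi u * u ^ (2 * M) *
      ‖∑ k ∈ Finset.range (M + 1),
          ((((descPochhammer ℝ k).eval ((M : ℝ) - 1 / 2) / (Nat.factorial k : ℝ) : ℝ)) : ℂ) * (a / (u : ℂ) ^ 2) ^ k -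
        (1 + a / (u : ℂ) ^ 2) ^ ((((M : ℝ) - 1 / 2 : ℝ)) : ℂ)‖ := by
    rw [setIntegral_congr_fun measurableSet_Ioi hdiff]
    refine (norm_integral_le_integral_norm _).trans (le_of_eq ?_)
    refine setIntegral_congr_fun measurableSet_Ioi fun u hu ↦ ?_
    have hu0 : 0 < u := hc.trans hu
    rw [norm_mul, Complex.norm_real,
      Real.norm_of_nonneg (mul_nonneg (deBruijnPhi_pos_of_nonneg hu0.le).le (pow_nonneg hu0.le _))]
  calc ‖(∫ u in Set.Ioc 0 c, F u) + ∫ u in Set.Ioi c, (F u - g u)‖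
      ≤ ‖∫ u in Set.Ioc 0 c, F u‖ + ‖∫ u in Set.Ioi c, (F u - g u)‖ := norm_add_le _ _
    _ ≤ _ := add_le_add hn1 hn2

end Summit.RiemannHypothesis.RiemannHypothesis.Theorems.JensenPolynomials.FarGumbel
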